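import Literature.IUT.HodgeArakelov.ThetaEvaluationSettingModelAssembly2
import Literature.IUT.HodgeArakelov.CohomologyAutCoeffChange
import Literature.IUT.HodgeArakelov.CohomologyAutFunctorialityComp

/-!
# [IUTchII] Prop 2.2 (ii) at the MODEL — changing the LIFT of the pointed inversion: the automorphism-pair action
# of an inner twist `Ad(w) ∘ ι` is `w · (ι_*)`, so the orbit-form (R2) binder is lift-independent (proof-only)

S. Mochizuki, *Inter-universal Teichmüller theory II*, kurims manuscript (Dec. 2020; pages = kurims preprint render
IUTchII-kurims-url-5036b4059555) §2, Prop. 2.2 (ii) p. 66 («the condition of invariance with respect to `ι`»), Rmk. 1.4.1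
(ii) p. 28 (the pointed inversion is a `Δ`-OUTER automorphism: a lift is determined only up to inner automorphisms),
Rmk. 2.1.1 (i) p. 65 [cite: Mochizuki2012, Prop 2.2 (ii) p.66] (claim key DISPUTED, D-0012); [EtTh] (Publ. RIMS **45**
(2009), refereed; pages = PRIMS journal PDF) Prop. 1.4 (ii) p. 22 («`Θ̈(Ü) = −Θ̈(Ü⁻¹)`; `Θ̈(−Ü) = −Θ̈(Ü)`» — the two
natural lifts «`Ü ↦ Ü⁻¹`» and «`Ü ↦ −Ü⁻¹`» of the inversion differ by the deck involution and act on `Θ̈` by `−1` resp.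
`+1`), Thm. 1.6 (ii)/(iii) p. 24. Transport of structure in group cohomology: [NSW] I §5
[cite: NeukirchSchmidtWingberg2008, I §5].

PROOF-ONLY companion (cell abc-iut, seat abc-iut-w4-d010 gen 11 — node IUTchII:Prop2.2(ii) END-TO-END assembler lineage;
NO definitions, NO `Prop` facts; sub-row «P22ii-R2-ORBIT» part 3, sequel of `ThetaEvaluationSettingModelOfOrbitLift`
(p457679) and `BadPrimeGaussianMonoidsGenuineRecordOrbitOfOrbitLift` (p457998)). Those two files replaced the ε-PINNED
class-level inversion binder `h14iota : autMap(ι|, ι^Θ)(η̈|) = ε · η̈|` of every Prop 2.2 (ii) / Prop 3.1 (i) / Cor 3.5 (ii)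
closer by the ORBIT form `h14orbit : ∃ τ₀ ∈ Π^tp_Y̲̲, autMap(ι|, ι^Θ)(η̈|) = τ₀ · η̈|` (resp. the FIXED form, `τ₀ := 1`).
THIS FILE proves that the orbit form is what a `Δ`-OUTER datum deserves:
* GENERIC `ContH1Aut.autMap_eq_conj_autMap_of_innerTwist` — for automorphism pairs `(α, β)`, `(α', β')` with
  `α' = Ad(w) ∘ α` on `G` and `β' = Ad(φ w) ∘ β` on the coefficients `A`: `autMap (α', β') = ContH1.conj w ∘ autMap (α, β)`
  on `H¹(H, A)` (`H ⊴ G`) — cocycle-level identity (abc-iut-L6-t1's `autMap`, abc-iut-w4-d014's inner case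
  `autMap_eq_conj_of_inner` is `α = id`);
* `EtaleThetaDataOfSetting.thetaIso_eq_conj_of_innerTwist` — for lifts `ι`, `ι' = Ad(w) ∘ ι` of the inversion with
  theta companions `c`, `c'` ([EtTh] Thm. 1.6 (ii)), `c'.thetaIso = Ad(w^Θ) ∘ c.thetaIso` on `(Π^tp_X)^Θ` as soon as
  `(·)^Θ` is surjective (companions are determined by `comm`);
* `EtaleThetaDataOfSetting.autMap_inversion_innerTwist` — at the model `Π := Π^tp_X̲̲`: the pair of `ι' = Ad(w) ∘ ι`
  (`w ∈ Π^tp_X̲̲`) acts on `H¹(Π^tp_Ÿ̲̲, Δ_Θ)` as `w · (pair of ι)`;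
* `EtaleThetaDataOfSetting.h14orbit_iff_of_innerTwist` — for `w ∈ Π^tp_X̲̲ ∩ Π^tp_Y` the ORBIT binder holds for `ι'`
  iff it holds for `ι` (**lift-independence inside the `Π^tp_Y̲̲`-inner class**); `h14iota_of_h14fix_innerTwist` — if the
  lift `ι` FIXES `η̈|` (abc-iut-L2-d1's model theorems `transport_etaDdχ_twistedInversion` / `transport_etaDdχq`) then
  the ε-twisted lift `Ad(ε) ∘ ι` satisfies the landed ε-PINNED binder `h14iota` verbatim, and conversely
  (`h14fix_of_h14iota_innerTwist`).
So the section-fixing lift of the χ-models and print's tangential lift feed the SAME L6 consumer (CONE-L2-STATUS v3.5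
«instantiation needs a different lift (L6 consumers w4-d004/w4-d010)» — answered on the consumer side). Honest framing:
nothing of [EtTh]/[IUTchII] is asserted; the class-level content of [EtTh] Prop. 1.4 (ii) at the inversion stays a
hypothesis (GAP D-G-w4d010-2f, C-R25 (iv)); no side taken on [IUTchIII] Cor. 3.12. [claim: Mochizuki2012, status: disputed]
typed ≠ proved.
-/

namespace Literature.IUT.HodgeArakelov

open Literature.AnabelianGeometry.EtaleTheta (ContH1 ThetaSetting)
open Literature.AnabelianGeometry.EtaleTheta
open EtaleThetaDataOfSetting CohomologySystemOfContH1

universe u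

noncomputable section

/-! ## §1. Generic: an inner twist of an automorphism pair acts as `conj w ∘ autMap` -/

namespace ContH1Aut

variable {G : Type u} {G' : Type u} [Group G] [TopologicalSpace G] [IsTopologicalGroup G]
  [Group G'] [TopologicalSpace G'] [IsTopologicalGroup G']
  (φ : G →* G') (A : Subgroup G') [A.Normal] [IsMulCommutative A]

/-- **An inner twist of an automorphism pair acts as `conj w ∘ autMap`**: if `α' g = w · α(g) · w⁻¹` on `G` and
`β' a = φ(w) · β(a) · φ(w)⁻¹` on the coefficients `A`, then for `H ⊴ G` (stable under both pairs)
`autMap (α', β') x = ContH1.conj w (autMap (α, β) x)` on `H¹(H, A)` — the cocycle `β' ∘ f ∘ α'⁻¹` IS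
`h ↦ φ(w) · β(f(α⁻¹(w⁻¹ h w))) · φ(w)⁻¹`. (`α = id`: abc-iut-w4-d014's `autMap_eq_conj_of_inner`.)
[cite: NeukirchSchmidtWingberg2008, I §5] -/
theorem autMap_eq_conj_autMap_of_innerTwist (α α' : G ≃ₜ* G) (β β' : G' ≃ₜ* G')
    (hφ : ∀ g, β (φ g) = φ (α g)) (hφ' : ∀ g, β' (φ g) = φ (α' g))
    (hA : ∀ a : G', a ∈ A → β a ∈ A) (hA' : ∀ a : G', a ∈ A → β' a ∈ A)
    {H : Subgroup G} [H.Normal] (hH : ∀ x, x ∈ H → α.symm x ∈ H) (hH' : ∀ x, x ∈ H → α'.symm x ∈ H)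
    (w : G) (hαw : ∀ g, α' g = w * α g * w⁻¹) (hβw : ∀ a : G', a ∈ A → β' a = φ w * β a * (φ w)⁻¹)
    (x : ContH1 φ A H) :
    autMap φ A α' β' hφ' hA' hH' x = ContH1.conj φ A w (autMap φ A α β hφ hA hH x) := by
  induction x using QuotientGroup.induction_on with
  | H f =>
    rw [autMap_mk, autMap_mk, ContH1.conj_mk]
    apply congrArg (QuotientGroup.mk (s := (contCoboundaries φ A H).subgroupOf (contCocycles φ A H)))
    apply Subtype.ext
    funext y
    apply Subtype.ext
    -- the two evaluation points of `f` coincide: `α'⁻¹(y) = α⁻¹(w⁻¹ y w)`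
    have hy : (⟨α'.symm (y : G), hH' y y.2⟩ : H) =
        ⟨α.symm ((MulAut.conjNormal w⁻¹ y : H) : G), hH _ (MulAut.conjNormal w⁻¹ y).2⟩ := by
      apply Subtype.ext
      change α'.symm (y : G) = α.symm ((MulAut.conjNormal w⁻¹ y : H) : G)
      apply α'.injective
      rw [ContinuousMulEquiv.apply_symm_apply, hαw, ContinuousMulEquiv.apply_symm_apply, MulAut.conjNormal_apply,
        inv_inv]
      group
    rw [coe_autCocycle_apply, ContH1.conjCocycle_apply, MulAut.conjNormal_apply, coe_autCocycle_apply,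
      hβw _ (f.1 _).2, hy]

end ContH1Aut

/-! ## §2. At the model `Π := Π^tp_X̲̲`: two lifts of the pointed inversion differing by `Ad(w)`, `w ∈ Π^tp_X̲̲` -/

namespace EtaleThetaDataOfSetting

variable {p : ℕ} [Fact p.Prime] {D : Literature.AnabelianGeometry.EtaleTheta.ThetaSetting p}
  {E : D.EtaleThetaData} {l : ℕ} (C : E.DoubleUnderline l)
  (ι ι' : D.PiTemp ≃ₜ* D.PiTemp) (hι : C.Huu.map ι.toMulEquiv.toMonoidHom = C.Huu)
  (hι' : C.Huu.map ι'.toMulEquiv.toMonoidHom = C.Huu)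
  (c : ThetaSetting.ThetaCompanion ι) (c' : ThetaSetting.ThetaCompanion ι')

/-- `α' = Ad(w) ∘ α` for the restrictions `α := ι|_{Π^tp_X̲̲}`, `α' := ι'|_{Π^tp_X̲̲}` of two lifts `ι' = Ad(w) ∘ ι`, `w ∈ Π^tp_X̲̲`
([IUTchII] Rmk. 1.4.1 (ii): the pointed inversion is an OUTER automorphism). [cite: Mochizuki2012, Rmk 1.4.1 (ii) p.28] -/
theorem inversionAlpha_innerTwist (w : Pi C) (hιw : ∀ x : D.PiTemp, ι' x = (w : D.PiTemp) * ι x * (w : D.PiTemp)⁻¹)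
    (g : Pi C) :
    inversionAlpha C ι' hι' g = w * inversionAlpha C ι hι g * w⁻¹ := by
  apply Subtype.ext
  rw [coe_inversionAlpha, hιw]
  rfl

/-- **Theta companions of inner-twisted lifts**: if `ι' = Ad(w) ∘ ι` and `(·)^Θ : Π^tp_X → (Π^tp_X)^Θ` is surjective, then
for ANY theta companions `c` of `ι` and `c'` of `ι'` ([EtTh] Thm. 1.6 (ii)), `c'.thetaIso = Ad(w^Θ) ∘ c.thetaIso` — companions
are pinned by `comm : (·)^Θ ∘ ι = ι^Θ ∘ (·)^Θ`. [cite: MochizukiEtTh2009, Thm 1.6 (ii) p.24] -/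
theorem thetaIso_eq_conj_of_innerTwist (w : Pi C)
    (hιw : ∀ x : D.PiTemp, ι' x = (w : D.PiTemp) * ι x * (w : D.PiTemp)⁻¹)
    (hsurj : Function.Surjective D.toTheta) (a : D.GtpTheta) :
    c'.thetaIso a = D.toTheta (w : D.PiTemp) * c.thetaIso a * (D.toTheta (w : D.PiTemp))⁻¹ := by
  obtain ⟨y, rfl⟩ := hsurj a
  have h1 : c.thetaIso (D.toTheta y) = D.toTheta (ι y) := (c.comm y).symm
  have h2 : c'.thetaIso (D.toTheta y) = D.toTheta (ι' y) := (c'.comm y).symm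
  rw [h2, h1, hιw, map_mul, map_mul, map_inv]

/-- **The automorphism-pair action of an inner-twisted lift**: on `H¹(Π^tp_Ÿ̲̲ ∩ ⊤, Δ_Θ)` the pair
`(ι'|_{Π^tp_X̲̲}, ι'^Θ)` of `ι' = Ad(w) ∘ ι` (`w ∈ Π^tp_X̲̲`, companions related by `Ad(w^Θ)` on `Δ_Θ`) acts as `w · (pair of ι)`:
`autMap(ι'|, ι'^Θ) x = ContH1.conj w (autMap(ι|, ι^Θ) x)`. [cite: Mochizuki2012, Prop 2.2 (ii) p.66] -/
theorem autMap_inversion_innerTwist [hN : (PiYdd C).Normal] (w : Pi C)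
    (hιw : ∀ x : D.PiTemp, ι' x = (w : D.PiTemp) * ι x * (w : D.PiTemp)⁻¹)
    (hcw : ∀ a : D.GtpTheta, a ∈ D.DeltaTheta →
      c'.thetaIso a = D.toTheta (w : D.PiTemp) * c.thetaIso a * (D.toTheta (w : D.PiTemp))⁻¹)
    (hH : ∀ x, x ∈ PiYdd C ⊓ ⊤ → (inversionAlpha C ι hι).symm x ∈ PiYdd C ⊓ ⊤)
    (hH' : ∀ x, x ∈ PiYdd C ⊓ ⊤ → (inversionAlpha C ι' hι').symm x ∈ PiYdd C ⊓ ⊤)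
    (x : ContH1 (phi C) D.DeltaTheta (PiYdd C ⊓ ⊤)) :
    ContH1Aut.autMap (phi C) D.DeltaTheta (inversionAlpha C ι' hι') c'.thetaIso (thetaCompanion_phi C ι' hι' c')
        (thetaCompanion_mem_deltaTheta ι' c') hH' x =
      ContH1.conj (phi C) D.DeltaTheta w
        (ContH1Aut.autMap (phi C) D.DeltaTheta (inversionAlpha C ι hι) c.thetaIso (thetaCompanion_phi C ι hι c)
          (thetaCompanion_mem_deltaTheta ι c) hH x) :=
  ContH1Aut.autMap_eq_conj_autMap_of_innerTwist (phi C) D.DeltaTheta (inversionAlpha C ι hι) (inversionAlpha C ι' hι')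
    c.thetaIso c'.thetaIso (thetaCompanion_phi C ι hι c) (thetaCompanion_phi C ι' hι' c')
    (thetaCompanion_mem_deltaTheta ι c) (thetaCompanion_mem_deltaTheta ι' c') hH hH' w
    (inversionAlpha_innerTwist C ι ι' hι hι' w hιw) hcw x

/-! ## §3. The (R2) class-level binder across lifts -/

/-- **LIFT-INDEPENDENCE of the ORBIT binder inside the `Π^tp_Y̲̲`-inner class**: for `w ∈ Π^tp_X̲̲ ∩ Π^tp_Y` and
`ι' = Ad(w) ∘ ι`, «`ι'_*` carries `η̈^Θ|_{Π^tp_Ÿ̲̲}` into its `Π^tp_Y̲̲`-orbit» iff «`ι_*` does» (binder `h14orbit` of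
`prop22_ii'_model_of_inversion_of_classLevel_orbit`, p457679, for `ι'` iff for `ι`). [cite: Mochizuki2012, Prop 2.2 (ii) p.66] -/
theorem h14orbit_iff_of_innerTwist [hN : (PiYdd C).Normal] (hchar : PiYddCharacteristic C) (w : Pi C)
    (hιw : ∀ x : D.PiTemp, ι' x = (w : D.PiTemp) * ι x * (w : D.PiTemp)⁻¹)
    (hcw : ∀ a : D.GtpTheta, a ∈ D.DeltaTheta →
      c'.thetaIso a = D.toTheta (w : D.PiTemp) * c.thetaIso a * (D.toTheta (w : D.PiTemp))⁻¹)
    (hw : (w : D.PiTemp) ∈ D.GtpY) :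
    (∃ τ₀ : Pi C, (τ₀ : D.PiTemp) ∈ D.GtpY ∧
      ContH1Aut.autMap (phi C) D.DeltaTheta (inversionAlpha C ι' hι') c'.thetaIso
        (thetaCompanion_phi C ι' hι' c') (thetaCompanion_mem_deltaTheta ι' c')
        (symm_mem_inf_top (PiYdd C) (inversionAlpha C ι' hι') (mem_PiYdd_iff_of_piYddCharacteristic C hchar _))
        (ContH1.comap D.toTheta D.DeltaTheta C.Huu.subtype continuous_subtype_val
          (map_subtype_piYdd_inf_le_GtpYdd C ⊤) E.etaDd) =
      ContH1.conj (phi C) D.DeltaTheta τ₀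
        (ContH1.comap D.toTheta D.DeltaTheta C.Huu.subtype continuous_subtype_val
          (map_subtype_piYdd_inf_le_GtpYdd C ⊤) E.etaDd)) ↔
    (∃ τ₀ : Pi C, (τ₀ : D.PiTemp) ∈ D.GtpY ∧
      ContH1Aut.autMap (phi C) D.DeltaTheta (inversionAlpha C ι hι) c.thetaIso
        (thetaCompanion_phi C ι hι c) (thetaCompanion_mem_deltaTheta ι c)
        (symm_mem_inf_top (PiYdd C) (inversionAlpha C ι hι) (mem_PiYdd_iff_of_piYddCharacteristic C hchar _))
        (ContH1.comap D.toTheta D.DeltaTheta C.Huu.subtype continuous_subtype_val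
          (map_subtype_piYdd_inf_le_GtpYdd C ⊤) E.etaDd) =
      ContH1.conj (phi C) D.DeltaTheta τ₀
        (ContH1.comap D.toTheta D.DeltaTheta C.Huu.subtype continuous_subtype_val
          (map_subtype_piYdd_inf_le_GtpYdd C ⊤) E.etaDd)) := by
  rw [autMap_inversion_innerTwist C ι ι' hι hι' c c' w hιw hcw]
  constructor
  · rintro ⟨τ₀, hτ₀, h⟩
    refine ⟨w⁻¹ * τ₀, D.GtpY.mul_mem (D.GtpY.inv_mem hw) hτ₀, ?_⟩
    rw [ContH1.conj_mul_apply, ← h, ContH1.conj_inv_conj_apply]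
  · rintro ⟨τ₀, hτ₀, h⟩
    refine ⟨w * τ₀, D.GtpY.mul_mem hw hτ₀, ?_⟩
    rw [ContH1.conj_mul_apply, h]

/-- **From a lift FIXING `η̈^Θ|` to the ε-PINNED binder of the ε-twisted lift**: if `ι_*` fixes `η̈^Θ|_{Π^tp_Ÿ̲̲}` (binder
`h14fix`; abc-iut-L2-d1's `transport_etaDdχ_twistedInversion` / `transport_etaDdχq` at the χ-models) then the lift
`ι' = Ad(w) ∘ ι` satisfies `ι'_*(η̈|) = w · η̈|` — for `w := ε` a deck element this is VERBATIM the landed ε-pinned binder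
`h14iota` of `prop22_ii'_model_of_inversion_of_classLevel` (p417690) / `…_of_prop15_of_origin` (p430763).
[cite: MochizukiEtTh2009, Prop 1.4 (ii) p.22] -/
theorem h14iota_of_h14fix_innerTwist [hN : (PiYdd C).Normal] (hchar : PiYddCharacteristic C) (w : Pi C)
    (hιw : ∀ x : D.PiTemp, ι' x = (w : D.PiTemp) * ι x * (w : D.PiTemp)⁻¹)
    (hcw : ∀ a : D.GtpTheta, a ∈ D.DeltaTheta →
      c'.thetaIso a = D.toTheta (w : D.PiTemp) * c.thetaIso a * (D.toTheta (w : D.PiTemp))⁻¹)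
    (h14fix : ContH1Aut.autMap (phi C) D.DeltaTheta (inversionAlpha C ι hι) c.thetaIso
        (thetaCompanion_phi C ι hι c) (thetaCompanion_mem_deltaTheta ι c)
        (symm_mem_inf_top (PiYdd C) (inversionAlpha C ι hι) (mem_PiYdd_iff_of_piYddCharacteristic C hchar _))
        (ContH1.comap D.toTheta D.DeltaTheta C.Huu.subtype continuous_subtype_val
          (map_subtype_piYdd_inf_le_GtpYdd C ⊤) E.etaDd) =
      ContH1.comap D.toTheta D.DeltaTheta C.Huu.subtype continuous_subtype_val
        (map_subtype_piYdd_inf_le_GtpYdd C ⊤) E.etaDd) :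
    ContH1Aut.autMap (phi C) D.DeltaTheta (inversionAlpha C ι' hι') c'.thetaIso
        (thetaCompanion_phi C ι' hι' c') (thetaCompanion_mem_deltaTheta ι' c')
        (symm_mem_inf_top (PiYdd C) (inversionAlpha C ι' hι') (mem_PiYdd_iff_of_piYddCharacteristic C hchar _))
        (ContH1.comap D.toTheta D.DeltaTheta C.Huu.subtype continuous_subtype_val
          (map_subtype_piYdd_inf_le_GtpYdd C ⊤) E.etaDd) =
      ContH1.conj (phi C) D.DeltaTheta w
        (ContH1.comap D.toTheta D.DeltaTheta C.Huu.subtype continuous_subtype_val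
          (map_subtype_piYdd_inf_le_GtpYdd C ⊤) E.etaDd) := by
  rw [autMap_inversion_innerTwist C ι ι' hι hι' c c' w hιw hcw
    (symm_mem_inf_top (PiYdd C) (inversionAlpha C ι hι) (mem_PiYdd_iff_of_piYddCharacteristic C hchar _)), h14fix]

/-- **Conversely**: if the lift `ι' = Ad(w) ∘ ι` satisfies the `w`-pinned binder (`ι'_*(η̈|) = w · η̈|`), then `ι_*` FIXES `η̈|`.
So the landed ε-pinned `h14iota` for print's tangential lift and `h14fix` for the section-fixing lift of the χ-models are
the SAME datum. [cite: MochizukiEtTh2009, Prop 1.4 (ii) p.22] -/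
theorem h14fix_of_h14iota_innerTwist [hN : (PiYdd C).Normal] (hchar : PiYddCharacteristic C) (w : Pi C)
    (hιw : ∀ x : D.PiTemp, ι' x = (w : D.PiTemp) * ι x * (w : D.PiTemp)⁻¹)
    (hcw : ∀ a : D.GtpTheta, a ∈ D.DeltaTheta →
      c'.thetaIso a = D.toTheta (w : D.PiTemp) * c.thetaIso a * (D.toTheta (w : D.PiTemp))⁻¹)
    (h14w : ContH1Aut.autMap (phi C) D.DeltaTheta (inversionAlpha C ι' hι') c'.thetaIso
        (thetaCompanion_phi C ι' hι' c') (thetaCompanion_mem_deltaTheta ι' c')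
        (symm_mem_inf_top (PiYdd C) (inversionAlpha C ι' hι') (mem_PiYdd_iff_of_piYddCharacteristic C hchar _))
        (ContH1.comap D.toTheta D.DeltaTheta C.Huu.subtype continuous_subtype_val
          (map_subtype_piYdd_inf_le_GtpYdd C ⊤) E.etaDd) =
      ContH1.conj (phi C) D.DeltaTheta w
        (ContH1.comap D.toTheta D.DeltaTheta C.Huu.subtype continuous_subtype_val
          (map_subtype_piYdd_inf_le_GtpYdd C ⊤) E.etaDd)) :
    ContH1Aut.autMap (phi C) D.DeltaTheta (inversionAlpha C ι hι) c.thetaIso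
        (thetaCompanion_phi C ι hι c) (thetaCompanion_mem_deltaTheta ι c)
        (symm_mem_inf_top (PiYdd C) (inversionAlpha C ι hι) (mem_PiYdd_iff_of_piYddCharacteristic C hchar _))
        (ContH1.comap D.toTheta D.DeltaTheta C.Huu.subtype continuous_subtype_val
          (map_subtype_piYdd_inf_le_GtpYdd C ⊤) E.etaDd) =
      ContH1.comap D.toTheta D.DeltaTheta C.Huu.subtype continuous_subtype_val
        (map_subtype_piYdd_inf_le_GtpYdd C ⊤) E.etaDd := by
  rw [autMap_inversion_innerTwist C ι ι' hι hι' c c' w hιw hcw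
    (symm_mem_inf_top (PiYdd C) (inversionAlpha C ι hι) (mem_PiYdd_iff_of_piYddCharacteristic C hchar _))] at h14w
  exact (ContH1.conj_bijective (φ := phi C) (A := D.DeltaTheta) w).1 h14w

end EtaleThetaDataOfSetting

end

end Literature.IUT.HodgeArakelov
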